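import Summits.Ventures.PercRepro.SwapBijection

/-!
# Decision trees build recoverable edge sets (Gladkov–Zimin Lemma 4.2, tree form)

A decision tree on the edge type `E` queries one edge at a time, sees its state in BOTH
configurations, sends the edge to `S` or to `Sᶜ`, and continues with a subtree chosen from the
two revealed bits; a leaf stops and sends every unqueried edge to `Sᶜ` (Gladkov–Zimin
arXiv:2404.08873 §4, Gladkov arXiv:2408.08457 §2).  `DTree.run t ω ω'` is the edge set `S`
such a tree builds from the pair `(ω, ω')`; `DTree.Proper t Q` says that no edge of `Q` and no
edge twice along a path is queried (a tree run from scratch is `Proper t ∅`).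

**Lemma 4.2, static form** (`DTree.recoverable`): the edge set built by a proper tree is
recoverable from the swapped pair — the tree is replayed on `(ω →_{Sᶜ} ω', ω →_S ω')`, reading at
each node the pair of bits in the order fixed by the node's own `S`/`Sᶜ` decision
(`DTree.replay`, `DTree.replay_mix`).  Hence, by `sum_swapPair`, the swapped pair built by ANY
decision tree is again a pair of independent configurations (`DTree.sum_swap`,
`DTree.prob_mul_prob_eq_sum_swap`, `DTree.sum_indicator_mix_eq_prob`).
-/

namespace PercRepro

/-- A decision tree over the edge type `E`: a leaf (stop; everything unqueried goes to `Sᶜ`),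
or a node that queries the edge `e`, sends it to `S` iff `toS`, and continues with the subtree
`next b b'` where `b, b'` are the states of `e` in the two configurations. -/
inductive DTree (E : Type*) where
  /-- stop -/
  | leaf : DTree E
  /-- query `e`; `toS` says whether `e` joins `S`; `next b b'` continues on the revealed bits -/
  | node (e : E) (toS : Bool) (next : Bool → Bool → DTree E) : DTree E

namespace DTree

variable {E : Type*}

/-- The edge set `S` built by the tree from the pair `(ω, ω')`. -/
def run : DTree E → Config E → Config E → Set E
  | leaf, _, _ => ∅
  | node e toS next, ω, ω' => (if toS then {e} else ∅) ∪ run (next (ω e) (ω' e)) ω ω'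

/-- Replay the tree on a pair `(φ₁, φ₂)` that is the SWAP of the original pair: at a node sent
to `S` the original bits `(ω e, ω' e)` are `(φ₂ e, φ₁ e)`, at a node sent to `Sᶜ` they are
`(φ₁ e, φ₂ e)`. -/
def replay : DTree E → Config E → Config E → Set E
  | leaf, _, _ => ∅
  | node e true next, φ₁, φ₂ => {e} ∪ replay (next (φ₂ e) (φ₁ e)) φ₁ φ₂
  | node e false next, φ₁, φ₂ => replay (next (φ₁ e) (φ₂ e)) φ₁ φ₂

/-- `Proper t Q`: the tree queries no edge of `Q` and no edge twice along a path. -/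
def Proper : DTree E → Set E → Prop
  | leaf, _ => True
  | node e _ next, Q => e ∉ Q ∧ ∀ b b', Proper (next b b') (insert e Q)

/-- An edge already queried (in `Q`) never enters the set built by a proper tree. -/
theorem not_mem_run_of_mem {t : DTree E} {Q : Set E} (ht : Proper t Q) {e : E} (he : e ∈ Q)
    (ω ω' : Config E) : e ∉ run t ω ω' := by
  induction t generalizing Q with
  | leaf => simp [run]
  | node e' toS next ih =>
    obtain ⟨he', hnext⟩ := ht
    have hne : e ≠ e' := fun h => he' (h ▸ he)
    simp only [run, Set.mem_union, not_or]
    refine ⟨?_, ih _ _ (hnext (ω e') (ω' e')) (Set.mem_insert_of_mem _ he)⟩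
    split_ifs <;> simp [hne]

/-- **The replay recovers the built set.**  If `T` agrees with `run t ω ω'` on every edge not
already queried, the replay of a proper tree on the pair swapped along `T` returns
`run t ω ω'`. -/
theorem replay_mix {t : DTree E} {Q : Set E} (ht : Proper t Q) (ω ω' : Config E) (T : Set E)
    (hT : ∀ e, e ∉ Q → (e ∈ T ↔ e ∈ run t ω ω')) :
    replay t (mix Tᶜ ω ω') (mix T ω ω') = run t ω ω' := by
  induction t generalizing Q with
  | leaf => simp [replay, run]
  | node e toS next ih =>
    obtain ⟨heQ, hnext⟩ := ht
    have hno : e ∉ run (next (ω e) (ω' e)) ω ω' :=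
      not_mem_run_of_mem (hnext _ _) (Set.mem_insert e Q) ω ω'
    -- the set built by the subtree agrees with `T` off `insert e Q`
    have hsub : ∀ e', e' ∉ insert e Q → (e' ∈ T ↔ e' ∈ run (next (ω e) (ω' e)) ω ω') := by
      intro e' he'
      have hne : e' ≠ e := fun h => he' (h ▸ Set.mem_insert e Q)
      have he'Q : e' ∉ Q := fun h => he' (Set.mem_insert_of_mem _ h)
      rw [hT e' he'Q]
      simp only [run, Set.mem_union]
      constructor
      · rintro (h | h)
        · exfalso
          split_ifs at h
          · exact hne (Set.mem_singleton_iff.mp h)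
          · exact h
        · exact h
      · exact fun h => Or.inr h
    have hih := ih _ _ (hnext (ω e) (ω' e)) hsub
    cases toS with
    | true =>
      have heT : e ∈ T := (hT e heQ).mpr (by simp [run])
      simp only [replay, run, mix_apply_of_mem heT, mix_compl_apply_of_mem heT, if_true]
      rw [hih]
    | false =>
      have heT : e ∉ T := fun h => by
        have := (hT e heQ).mp h
        simp only [run, Set.mem_union, Bool.false_eq_true, if_false, Set.mem_empty_iff_false,
          false_or] at this
        exact hno this
      simp only [replay, run, mix_apply_of_notMem heT, mix_compl_apply_of_notMem heT,
        Bool.false_eq_true, if_false, Set.empty_union]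
      exact hih

/-- **GZ24 Lemma 4.2, static tree form**: the edge set built by a proper decision tree is
recoverable from the swapped pair. -/
theorem recoverable {t : DTree E} (ht : Proper t ∅) : Recoverable (fun ω ω' => run t ω ω') :=
  ⟨fun φ₁ φ₂ => replay t φ₁ φ₂, fun ω ω' =>
    replay_mix ht ω ω' (run t ω ω') fun _ _ => Iff.rfl⟩

variable [Fintype E] [DecidableEq E]

/-- The swapped pair built by a proper decision tree is distributed like the original pair. -/
theorem sum_swap (p : E → ℝ) {t : DTree E} (ht : Proper t ∅) (F : Config E → Config E → ℝ) :
    ∑ ω, ∑ ω', weight p ω * weight p ω' *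
        F (mix (run t ω ω')ᶜ ω ω') (mix (run t ω ω') ω ω') =
      ∑ ω, ∑ ω', weight p ω * weight p ω' * F ω ω' :=
  sum_swapPair p (recoverable ht) F

/-- `P(ω →_{Sᶜ} ω' ∈ X ∧ ω →_S ω' ∈ Y) = P(X) · P(Y)` for the set `S` built by a proper
decision tree (GZ24 Lemma 4.2). -/
theorem prob_mul_prob_eq_sum_swap (p : E → ℝ) {t : DTree E} (ht : Proper t ∅)
    (X Y : Set (Config E)) :
    prob p X * prob p Y =
      ∑ ω, ∑ ω', weight p ω * weight p ω' *
        (X.indicator 1 (mix (run t ω ω')ᶜ ω ω') * Y.indicator 1 (mix (run t ω ω') ω ω')) :=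
  PercRepro.prob_mul_prob_eq_sum_swap p (recoverable ht) X Y

/-- `P(ω →_S ω' ∈ Y) = P(Y)` for the set `S` built by a proper decision tree. -/
theorem sum_indicator_mix_eq_prob (p : E → ℝ) {t : DTree E} (ht : Proper t ∅)
    (Y : Set (Config E)) :
    ∑ ω, ∑ ω', weight p ω * weight p ω' * Y.indicator 1 (mix (run t ω ω') ω ω') = prob p Y :=
  PercRepro.sum_indicator_mix_eq_prob p (recoverable ht) Y

end DTree

end PercRepro
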